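/-
Copyright (c) 2026. All rights reserved.
Released under Apache 2.0 license as described in the file LICENSE.
Authors: HodgeCM publication cell (pub-hodgecm), GR lane, seat GR-1 (`pub-hodgecm-own-real34`).
-/
import Literature.NumberTheory.GelbartRogawski1991.DoubledWeilRepresentationArchLiftGen
import Literature.NumberTheory.Weil1964.ArchMetaplecticSiegelValueSign
import HarnessLib

/-!
# The doubled Weil representation, archimedean half (II′): the archimedean lift on a Siegel parabolic that is NOT
# generated by squares — signed modulus and Levi representatives (general `E/F`, `E` with real places allowed)

Topic `NumberTheory/GelbartRogawski1991`; namespace `Literature.NumberTheory.GelbartRogawski1991.GRConstructionGen`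
(vocabulary of `DoubledUnitaryGlobalSplittingDataGen`).  KERNEL only: proved theorems; no definition, no named fact,
no `sorry`.

This is the companion of `DoubledWeilRepresentationArchLiftGen` (`isArchHalf_twist_archLift`, stated for `E` TOTALLY
COMPLEX) that serves the real places of `E` — the archimedean places of type (ii) of [GelbartRogawski1991, Prop. 3.1.1]
(a real place `v` of `F` split in `E`, `U(J^𝔻)(F_v) ≅ GL_{n+n}(ℝ)`).  Two things change there, and this file isolates
exactly them:

* **the modulus input is SIGNED.**  For `g ∈ P_Δ(F ⊗ ℝ)` the diagonal action `A` of `ι^𝔻(g,1)` on `Res Δ ⊗ ℝ` has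
  `det A = ∏_{w real} det(g|Δ_w) · ∏_{w complex} |det(g|Δ_w)|² = (sign) · |det_Δ (g,1)|_{𝔸_E}`, of either sign.  So the
  hypothesis `hdiag` of the totally complex file (`0 < det A`, `det A = modDelta²`) becomes `hdiagS`:
  `det A = sgnA(g) · modDelta²` for an ARBITRARY real function `sgnA` (§1), and the squares condition on the twisting
  character `η` becomes `hηS`: `η(g)² · quot(sW g) · sgnA(g) = χ(det_Δ (g,1))²` (the sign of the Levi block enters the
  value-at-the-origin formula through `quot (m(a,d)) = sign det a`, `ArchMetaplecticSiegelValueSign`);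
* **`P_Δ(F ⊗ ℝ)` is no longer generated by squares** (`GL_ι(ℝ) = ⟨squares⟩ · {1, ε}`): two multiplicative scalars on
  `P_Δ(F ⊗ ℝ)` with equal squares agree as soon as they agree on a set `Q` of REPRESENTATIVES with
  `P_Δ(F ⊗ ℝ) = ⟨squares⟩ · Q` (§2; the representatives of record are the Cayley–Levi elements of sign patterns of
  `UnitaryGroupArchSiegelSquaresReps`, but `Q` is a parameter here).

Results (same telescope `(F E c hcδ hδ hd e TV hV hVd TW hW hWd) jA hjA eW sW hfin hdict sa hsa` as the totally complex
file; `z` any element of `Mp^𝓢` over the archimedean phase map of Weil's `r(δ)`):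

* §1 **`exists_originValue_sq_signed`** — on `P_Δ(F ⊗ ℝ)` the origin value of `r_δ (sa ⊗ η)(g) r_δ⁻¹` is a scalar
  `κ_g` with `κ_g² = (χ(det_Δ)|det_Δ|^{1/2})²`, given `hdiagS`, `hηS`;
* §2 **`parabolicPrescribed_twist_of_reps`** — if moreover every `p ∈ P_Δ(F ⊗ ℝ)` is `(∏ qᵢ²) · (∏ⱼ rⱼ)` with `qᵢ ∈ P_Δ`,
  `rⱼ ∈ Q ⊆ P_Δ` (so `Q` may be a mere GENERATING set of representatives), and the prescription HOLDS ON `Q` (`hval`: the origin value of `r_δ (sa ⊗ η)(q) r_δ⁻¹` is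
  `χ(det_Δ (q,1)) |det_Δ (q,1)|^{1/2}` for `q ∈ Q`), then `ParabolicPrescribed χ (sa ⊗ η)`; and
  **`isArchHalf_twist_archLift_of_reps`** — `IsArchHalf χ (sa ⊗ η)`.
* §3 `originValue_twist_eq` — bookkeeping for `hval`: the origin value of `r_δ (sa ⊗ η)(q) r_δ⁻¹` is `η(q) · c` when
  that of `z · sW(q) · z⁻¹` is `c` (so `hval` is a statement about the framed section `sW` alone; for the Levi sign
  representatives it is discharged by `Weil1964.MpS.conj_leviGL_apply_zero_of_orthogonal`: `c = 1`).

With `Q = {1}` and `sgnA = 1` this is the totally complex file again.  ([GelbartRogawski1991, §3.1 Prop. 3.1.1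
p. 455]; [Kudla1994, §3] incl. the case `E_v = F_v ⊕ F_v`; [HarrisKudlaSweet1996, §1 (1.11)–(1.15)]; [Weil1964,
Chap. III n° 46 (42)]; [Folland1989, §4.2 (4.24), Thm. (4.37)]; [Adams2007, §5 Rem. 5.6]: the `det^{1/2}` cover of
`GL_n(ℝ)` does not split, whence the signs.)  Written for the stage-1 cell `pub-hodgecm` (GR lane, seat GR-1);
nothing here is a claim of the manuscripts adjudicated by that cell.

## References

* S. Gelbart, J. Rogawski, Invent. Math. 105 (1991), §3.1 Prop. 3.1.1 p. 455 [GelbartRogawski1991].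
* S. S. Kudla, Israel J. Math. 87 (1994), §3 [Kudla1994].
* M. Harris, S. S. Kudla, W. J. Sweet, J. AMS 9 (1996), §1 [HarrisKudlaSweet1996].
* A. Weil, Acta Math. 111 (1964), Chap. III n° 46 (42) p. 202 [Weil1964].
* G. B. Folland, *Harmonic Analysis in Phase Space*, Princeton UP 1989, §4.2 (4.24), Thm. (4.37) [Folland1989].
* J. Adams, *The theta correspondence over ℝ* (2007), §5 Rem. 5.6 [Adams2007].
-/

set_option autoImplicit false

noncomputable section

open scoped Classical
open scoped Matrix Kronecker TensorProduct
open NumberField IsDedekindDomain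
open Literature.RepresentationTheory.HeisenbergGroup
open Literature.NumberTheory.Automorphic
open Literature.NumberTheory.Weil1964
open Literature.NumberTheory.GaloisRepresentations
open Literature.Analysis.SegalBargmann


namespace Literature.NumberTheory.GelbartRogawski1991.GRConstructionGen

open UnitaryDualPair

variable (F : Type) [Field F] [NumberField F] (E : Type) [Field E] [NumberField E] [Algebra F E]
  [Algebra.IsQuadraticExtension F E]
variable (c : E ≃ₐ[F] E) {δ : E} (hcδ : c δ = -δ) (hδ : δ ≠ 0) {d : F} (hd : δ * δ = algebraMap F E d)
variable {N M n : ℕ} (e : Fin N × Fin M ≃ Fin n)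
  (TV : Matrix (Fin N) (Fin N) F) (hV : TV.IsSymm) (hVd : IsUnit TV.det)
  (TW : Matrix (Fin M) (Fin M) F) (hW : TW.IsSymm) (hWd : IsUnit TW.det)

variable (jA : UnitaryGroup.arch F E c (n + n) (hermD F E e TV TW) →* HA F E c e TV TW)
  (hjA : jA = UnitaryGroup.archToAdelic F E c (n + n) (hermD F E e TV TW))

variable {σ : Type*} [Fintype σ] [DecidableEq σ]
  (eW : (Fin (n + n) → mixedEmbedding.mixedSpace F) ≃L[ℝ] (σ → ℝ))
  (sW : UnitaryGroup.arch F E c (n + n) (hermD F E e TV TW) →* MpS σ)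
  (hfin : ∀ (g : UnitaryGroup.arch F E c (n + n) (hermD F E e TV TW)) (k k' : Fin (n + n) → FiniteAdeleRing (𝓞 F) F),
    (((toSpD F E c hcδ hδ hd e TV hV TW hW).comp jA) g).1 (finVec k, finVec k') = (finVec k, finVec k'))
  (hdict : ∀ g : UnitaryGroup.arch F E c (n + n) (hermD F E e TV TW),
    archPhaseMap (gramDA F e TV TW) eW (isUnit_archMat_gramDA F e TV hVd TW hWd) (((toSpD F E c hcδ hδ hd e TV hV TW hW).comp jA) g) =
      ⇑((MpS.proj (sW g)).1 : ((σ → ℝ) × (σ → ℝ)) ≃ₗ[ℝ] ((σ → ℝ) × (σ → ℝ))))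
  (sa : UnitaryGroup.arch F E c (n + n) (hermD F E e TV TW) →* MpD F e TV TW)
  (hsa : sa = archLift (gramDA F e TV TW) eW (isUnit_archMat_gramDA F e TV hVd TW hWd)
        ((toSpD F E c hcδ hδ hd e TV hV TW hW).comp jA) sW hfin hdict)
  -- the SIGNED archimedean modulus input: `det A = sgnA(g) · modDelta (g,1)²`
  (sgnA : UnitaryGroup.arch F E c (n + n) (hermD F E e TV TW) → ℝ)
  (hdiagS : ∀ g : UnitaryGroup.arch F E c (n + n) (hermD F E e TV TW), IsSiegelDelta F E c e TV TW (jA g) →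
    ∃ A : ((Fin n → mixedEmbedding.mixedSpace F) × (Fin n → mixedEmbedding.mixedSpace F)) ≃ₗ[ℝ]
        ((Fin n → mixedEmbedding.mixedSpace F) × (Fin n → mixedEmbedding.mixedSpace F)),
      (∀ az : (Fin n → mixedEmbedding.mixedSpace F) × (Fin n → mixedEmbedding.mixedSpace F),
        archAct (gramDA F e TV TW) (((toSpD F E c hcδ hδ hd e TV hV TW hW).comp jA) g)
            (Sum.elim az.1 az.1 ∘ ⇑(e₂ (n := n)).symm, Sum.elim az.2 az.2 ∘ ⇑(e₂ (n := n)).symm) =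
          (Sum.elim (A az).1 (A az).1 ∘ ⇑(e₂ (n := n)).symm, Sum.elim (A az).2 (A az).2 ∘ ⇑(e₂ (n := n)).symm)) ∧
      ((LinearMap.det (A : ((Fin n → mixedEmbedding.mixedSpace F) × (Fin n → mixedEmbedding.mixedSpace F)) →ₗ[ℝ]
          ((Fin n → mixedEmbedding.mixedSpace F) × (Fin n → mixedEmbedding.mixedSpace F))) : ℝ) : ℂ) =
        (sgnA g : ℂ) * ((modDelta F E c e TV TW (jA g) : ℝ) : ℂ) ^ 2)

/-! ## §1 The origin value of `r_δ (sa ⊗ η)(g) r_δ⁻¹` on `P_Δ(F ⊗ ℝ)`, signed modulus -/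

section Origin

include hsa hdiagS in
set_option maxHeartbeats 3200000 in
-- (the origin-value computation elaborates many `Mp(𝕎^𝔻)ᶜᵒⁿᵗ`/`𝓢` terms; instance unification is expensive)
/-- **the origin value of `r_δ (sa ⊗ η)(g) r_δ⁻¹` on `P_Δ(F ⊗ ℝ)`, SIGNED MODULUS**: a scalar `κ` with
`(ω(…)Φ)(0) = κ Φ(0)` and `κ² = (χ(det_Δ (g,1)) |det_Δ (g,1)|^{1/2})²`, provided `det A = sgnA(g) · modDelta²` (`hdiagS`)
and `η(g)² · quot(sW g) · sgnA(g) = χ(det_Δ (g,1))²` (`hηS`).  (Weil's origin value `u · |det a|^{-1/2}` of an implementer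
of `m(a,d) n(b)`, `u² · sign(det a) = quot`, `|det a|⁻¹ = |det d|`, `sign(det a)|det d| = det d = det A`.)
[cite: Weil1964, Chap. III n° 46 (42) p. 202] [cite: Folland1989, §4.2 (4.24), Thm. (4.37)] -/
theorem exists_originValue_sq_signed (χ : HeckeCharacter E) (η : UnitaryGroup.arch F E c (n + n) (hermD F E e TV TW) →* ℂˣ)
    (hηS : ∀ g : UnitaryGroup.arch F E c (n + n) (hermD F E e TV TW), IsSiegelDelta F E c e TV TW (jA g) →
      ((η g : ℂˣ) : ℂ) ^ 2 * MpS.quot (sW g) * (sgnA g : ℂ) = ((chiDet F E c e TV TW χ (jA g) : ℂˣ) : ℂ) ^ 2)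
    (A : SchwartzMap (Fin (n + n) → mixedEmbedding.mixedSpace F) ℂ ≃L[ℂ] SchwartzMap (Fin (n + n) → mixedEmbedding.mixedSpace F) ℂ) (P : FinSB F (Fin (n + n)) ≃ₗ[ℂ] FinSB F (Fin (n + n)))
    (hr : ∀ (Φ : SchwartzMap (Fin (n + n) → mixedEmbedding.mixedSpace F) ℂ) (f : FinSB F (Fin (n + n))),
      adelicMpCont.omega F (Fin (n + n)) (gramDA F e TV TW) (rDelta F e TV hVd TW hWd) (piSchwartzBruhatEquiv F (Fin (n + n)) (Φ ⊗ₜ f)) =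
        piSchwartzBruhatEquiv F (Fin (n + n)) (A Φ ⊗ₜ P f))
    (z : MpS σ)
    (hz' : (⇑((MpS.proj z).1 : ((σ → ℝ) × (σ → ℝ)) ≃ₗ[ℝ] ((σ → ℝ) × (σ → ℝ))) : ((σ → ℝ) × (σ → ℝ)) → ((σ → ℝ) × (σ → ℝ))) =
      archPhaseMap (gramDA F e TV TW) eW (isUnit_archMat_gramDA F e TV hVd TW hWd) (adelicMpCont.proj F (Fin (n + n)) (gramDA F e TV TW) (rDelta F e TV hVd TW hWd)))
    (g : UnitaryGroup.arch F E c (n + n) (hermD F E e TV TW)) (hS : IsSiegelDelta F E c e TV TW (jA g)) :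
    ∃ κ : ℂ, (∀ Φ, opD F e TV TW (rDelta F e TV hVd TW hWd * adelicMpCont.twist F (Fin (n + n)) (gramDA F e TV TW) sa η g * (rDelta F e TV hVd TW hWd)⁻¹) Φ 0 =
        κ * (Φ : (Fin (n + n) → AdeleRing (𝓞 F) F) → ℂ) 0) ∧
      κ ^ 2 = ((((chiDet F E c e TV TW χ (jA g) : ℂˣ) : ℂ) *
          (modDelta F E c e TV TW (jA g) : ℂ))) ^ 2 := by
  have hπr : adelicMpCont.proj F (Fin (n + n)) (gramDA F e TV TW) (rDelta F e TV hVd TW hWd) =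
      ratSp F (gramDA F e TV TW) (isUnit_det_gramDA F e TV hVd TW hWd) (deltaD F) :=
    projD_rDelta F e TV hVd TW hWd
  have hSi : IsSiegelDelta F E c e TV TW (jA g⁻¹) := by
    rw [map_inv]; exact isSiegelDelta_inv F E c e TV TW hS
  have hq : ∀ y : Fin (n + n) → AdeleRing (𝓞 F) F,
      ((adelicMpCont.proj F (Fin (n + n)) (gramDA F e TV TW) (rDelta F e TV hVd TW hWd) * ((toSpD F E c hcδ hδ hd e TV hV TW hW).comp jA) g *
          (adelicMpCont.proj F (Fin (n + n)) (gramDA F e TV TW) (rDelta F e TV hVd TW hWd))⁻¹).1 (0, y)).1 = 0 := by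
    intro y; rw [hπr]; exact conj_deltaD_toSpD_apply_zero_fst F E c hcδ hδ hd e TV hV hVd TW hW hWd _ hS y
  have hq' : ∀ y : Fin (n + n) → AdeleRing (𝓞 F) F,
      ((adelicMpCont.proj F (Fin (n + n)) (gramDA F e TV TW) (rDelta F e TV hVd TW hWd) * ((toSpD F E c hcδ hδ hd e TV hV TW hW).comp jA) g *
          (adelicMpCont.proj F (Fin (n + n)) (gramDA F e TV TW) (rDelta F e TV hVd TW hWd))⁻¹)⁻¹.1 (0, y)).1 = 0 := by
    intro y
    have hinv : (adelicMpCont.proj F (Fin (n + n)) (gramDA F e TV TW) (rDelta F e TV hVd TW hWd) * ((toSpD F E c hcδ hδ hd e TV hV TW hW).comp jA) g *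
          (adelicMpCont.proj F (Fin (n + n)) (gramDA F e TV TW) (rDelta F e TV hVd TW hWd))⁻¹)⁻¹ =
        ratSp F (gramDA F e TV TW) (isUnit_det_gramDA F e TV hVd TW hWd) (deltaD F) * toSpD F E c hcδ hδ hd e TV hV TW hW (jA g⁻¹) *
          (ratSp F (gramDA F e TV TW) (isUnit_det_gramDA F e TV hVd TW hWd) (deltaD F))⁻¹ := by
      rw [hπr]
      show (_ * toSpD F E c hcδ hδ hd e TV hV TW hW (jA g) * _)⁻¹ = _
      rw [map_inv jA g, map_inv (toSpD F E c hcδ hδ hd e TV hV TW hW)]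
      group
    rw [hinv]; exact conj_deltaD_toSpD_apply_zero_fst F E c hcδ hδ hd e TV hV hVd TW hW hWd _ hSi y
  obtain ⟨a, d, had, b, hb, u, hu, hdec, -, hwu, hval⟩ :=
    exists_siegel_of_conj (gramDA F e TV TW) eW (isUnit_archMat_gramDA F e TV hVd TW hWd) ((toSpD F E c hcδ hδ hd e TV hV TW hW).comp jA) sW hdict (rDelta F e TV hVd TW hWd) z hz' g hq hq'
  have hdy : ∀ y, d y = (archPhaseMap (gramDA F e TV TW) eW (isUnit_archMat_gramDA F e TV hVd TW hWd)
      (ratSp F (gramDA F e TV TW) (isUnit_det_gramDA F e TV hVd TW hWd) (deltaD F) * ((toSpD F E c hcδ hδ hd e TV hV TW hW).comp jA) g *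
        (ratSp F (gramDA F e TV TW) (isUnit_det_gramDA F e TV hVd TW hWd) (deltaD F))⁻¹) (0, y)).2 := by
    intro y
    rw [levi_snd_eq_archPhaseMap (gramDA F e TV TW) eW (isUnit_archMat_gramDA F e TV hVd TW hWd) ((toSpD F E c hcδ hδ hd e TV hV TW hW).comp jA) sW hdict (rDelta F e TV hVd TW hWd) z hz' g hdec y, hπr]
  -- the signed modulus: `det d = det A_g = sgnA(g) modDelta²`
  obtain ⟨Ag, hAg, hdetA⟩ := hdiagS g hS
  have hdd : ((LinearMap.det (d : (σ → ℝ) →ₗ[ℝ] (σ → ℝ)) : ℝ) : ℂ) = (sgnA g : ℂ) * ((modDelta F E c e TV TW (jA g) : ℝ) : ℂ) ^ 2 := by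
    rw [det_yBlock_eq_det F e TV hVd TW hWd eW _ Ag (fun az => hAg az) d hdy]
    exact hdetA
  -- `u² sign(det a) = quot (sW g)`, `leviFactor a² = |det d|`, `sign(det a)|det d| = det d`
  have hu2 : u ^ 2 * ((LinearMap.det (a : (σ → ℝ) →ₗ[ℝ] (σ → ℝ)) / |LinearMap.det (a : (σ → ℝ) →ₗ[ℝ] (σ → ℝ))| : ℝ) : ℂ) =
      MpS.quot (sW g) := by
    rw [MpS.sq_originScalar_mul_sign_eq_quot hwu, MpS.quot_conj]
  have hkey : (u * leviFactor a) ^ 2 = MpS.quot (sW g) * ((sgnA g : ℂ) * ((modDelta F E c e TV TW (jA g) : ℝ) : ℂ) ^ 2) := by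
    rw [mul_pow, MpS.leviFactor_sq_eq_abs_det a d had, ← hdd, ← hu2, MpS.abs_det_eq_sign_mul_det a d had,
      Complex.ofReal_mul, mul_assoc]
  -- the origin value of the untwisted conjugate
  subst hsa
  have h0 : ∀ Ψ : piSchwartzBruhat F (Fin (n + n)),
      ((adelicMpCont.omega F (Fin (n + n)) (gramDA F e TV TW)
          (rDelta F e TV hVd TW hWd * archLift (gramDA F e TV TW) eW (isUnit_archMat_gramDA F e TV hVd TW hWd)
        ((toSpD F E c hcδ hδ hd e TV hV TW hW).comp jA) sW hfin hdict g *
            (rDelta F e TV hVd TW hWd)⁻¹) Ψ : piSchwartzBruhat F (Fin (n + n))) : (Fin (n + n) → AdeleRing (𝓞 F) F) → ℂ) 0 =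
        (u * leviFactor a) * (Ψ : (Fin (n + n) → AdeleRing (𝓞 F) F) → ℂ) 0 :=
    fun Ψ => omega_conj_archLift_apply_zero (gramDA F e TV TW) eW (isUnit_archMat_gramDA F e TV hVd TW hWd) ((toSpD F E c hcδ hδ hd e TV hV TW hW).comp jA) sW hfin hdict (rDelta F e TV hVd TW hWd) A P hr z hz' g hval Ψ
  refine ⟨((η g : ℂˣ) : ℂ) * (u * leviFactor a), fun Φ => ?_, ?_⟩
  · rw [conj_twist_eq, opD_mul]
    simp only [opD, adelicMpCont.omega_ofScalar, Submodule.coe_smul, Pi.smul_apply, smul_eq_mul]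
    rw [h0]
    ring
  · rw [mul_pow, hkey, ← mul_assoc, ← mul_assoc, hηS g hS, mul_pow]

end Origin

/-! ## §2 The parabolic prescription from representatives; the archimedean half -/

section Parabolic

include hsa hdiagS in
set_option maxHeartbeats 1600000 in
-- (the assembly elaborates many `Mp(𝕎^𝔻)ᶜᵒⁿᵗ`/`𝓢` terms; instance unification is expensive)
/-- **`sa ⊗ η` has the prescribed origin values on `P_Δ(F ⊗ ℝ)` as soon as it has them on a set of REPRESENTATIVES
modulo squares.**  Hypotheses: the signed modulus `hdiagS` and squares condition `hηS` (so that the origin value `κ` of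
`r_δ (sa ⊗ η)(·) r_δ⁻¹` is a multiplicative scalar on `P_Δ(F ⊗ ℝ)` with `κ² = τ²`, `τ = χ(det_Δ)|det_Δ|^{1/2}`); a set
`Q ⊆ P_Δ(F ⊗ ℝ)` with `P_Δ(F ⊗ ℝ) = ⟨squares of P_Δ⟩ · ⟨Q⟩` (`hgen`: every `p` is a product of squares times a
product of elements of `Q`); and the prescription on `Q` (`hval`).  Then `ParabolicPrescribed χ (sa ⊗ η)` (`κ = τ` on
squares since `κ² = τ²`, on `Q` by hypothesis, everywhere by multiplicativity). [cite: GelbartRogawski1991, §3.1 Prop. 3.1.1 p. 455] [cite: HarrisKudlaSweet1996, §1 (1.11)–(1.15)] -/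
theorem parabolicPrescribed_twist_of_reps (χ : HeckeCharacter E) (η : UnitaryGroup.arch F E c (n + n) (hermD F E e TV TW) →* ℂˣ)
    (hηS : ∀ g : UnitaryGroup.arch F E c (n + n) (hermD F E e TV TW), IsSiegelDelta F E c e TV TW (jA g) →
      ((η g : ℂˣ) : ℂ) ^ 2 * MpS.quot (sW g) * (sgnA g : ℂ) = ((chiDet F E c e TV TW χ (jA g) : ℂˣ) : ℂ) ^ 2)
    (Q : Set (UnitaryGroup.arch F E c (n + n) (hermD F E e TV TW)))
    (hQ : ∀ q ∈ Q, IsSiegelDelta F E c e TV TW (jA q))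
    (hgen : ∀ p : UnitaryGroup.arch F E c (n + n) (hermD F E e TV TW), IsSiegelDelta F E c e TV TW (jA p) →
      ∃ (l m : List (UnitaryGroup.arch F E c (n + n) (hermD F E e TV TW))),
        (∀ q' ∈ l, IsSiegelDelta F E c e TV TW (jA q')) ∧ (∀ q ∈ m, q ∈ Q) ∧ p = (l.map fun q' => q' * q').prod * m.prod)
    (hval : ∀ q ∈ Q, ∀ Φ : piSchwartzBruhat F (Fin (n + n)),
      opD F e TV TW (rDelta F e TV hVd TW hWd * adelicMpCont.twist F (Fin (n + n)) (gramDA F e TV TW) sa η q * (rDelta F e TV hVd TW hWd)⁻¹) Φ 0 =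
        ((chiDet F E c e TV TW χ (jA q) : ℂˣ) : ℂ) * (modDelta F E c e TV TW (jA q) : ℂ) *
          (Φ : (Fin (n + n) → AdeleRing (𝓞 F) F) → ℂ) 0) :
    ParabolicPrescribed F E c e TV hVd TW hWd jA χ (adelicMpCont.twist F (Fin (n + n)) (gramDA F e TV TW) sa η) := by
  -- (1) the tensor form of `ω(r_F^𝔻(δ))` and a metaplectic reading `z` of `δ_∞`
  obtain ⟨A, P, hr⟩ := exists_omega_tmul (gramDA F e TV TW)
    (mulVec_surjective_of_isUnit_det F (gramDA F e TV TW) (isUnit_det_gramDA F e TV hVd TW hWd)) (rDelta F e TV hVd TW hWd)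
  obtain ⟨z, hz⟩ := exists_MpS_over_archPhaseMap (gramDA F e TV TW) eW (isUnit_archMat_gramDA F e TV hVd TW hWd)
    (ratSp F (gramDA F e TV TW) (isUnit_det_gramDA F e TV hVd TW hWd) (deltaD F))
  have hπr : adelicMpCont.proj F (Fin (n + n)) (gramDA F e TV TW) (rDelta F e TV hVd TW hWd) =
      ratSp F (gramDA F e TV TW) (isUnit_det_gramDA F e TV hVd TW hWd) (deltaD F) :=
    projD_rDelta F e TV hVd TW hWd
  have hz' : (⇑((MpS.proj z).1 : ((σ → ℝ) × (σ → ℝ)) ≃ₗ[ℝ] ((σ → ℝ) × (σ → ℝ))) : ((σ → ℝ) × (σ → ℝ)) → ((σ → ℝ) × (σ → ℝ))) =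
      archPhaseMap (gramDA F e TV TW) eW (isUnit_archMat_gramDA F e TV hVd TW hWd) (adelicMpCont.proj F (Fin (n + n)) (gramDA F e TV TW) (rDelta F e TV hVd TW hWd)) := by
    rw [hπr]; exact hz
  have horig := fun g hS =>
    exists_originValue_sq_signed F E c hcδ hδ hd e TV hV hVd TW hW hWd jA eW sW hfin hdict sa hsa sgnA hdiagS χ η hηS A P hr z hz' g hS
  -- (2) the origin-value scalar `κ` on `P_Δ(F ⊗ ℝ)` and its multiplicativity
  obtain ⟨Φ₀, hΦ₀⟩ : ∃ Φ : piSchwartzBruhat F (Fin (n + n)),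
      (Φ : (Fin (n + n) → AdeleRing (𝓞 F) F) → ℂ) 0 ≠ 0 := by
    refine ⟨piSchwartzBruhatEquiv F (Fin (n + n)) (unitSchwartz F (Fin (n + n)) ⊗ₜ[ℂ]
      indicatorSB F (Fin (n + n)) (piLevelIdeal F (Fin (n + n)) ⊤) (isOpen_piLevelIdeal F ⊤)
        (isCompact_piLevelIdeal F (Fin (n + n)) ⊤)), ?_⟩
    rw [coe_piSchwartzBruhatEquiv_tmul]
    have h0 : piArch F (Fin (n + n)) 0 = 0 := by
      funext i
      rw [piArch_apply, Pi.zero_apply]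
      exact map_zero (InfiniteAdeleRing.ringEquiv_mixedSpace F)
    have h1 : piFinite F (Fin (n + n)) 0 = 0 := rfl
    simp only [h0, h1, unitSchwartz_apply_zero, one_mul, coe_indicatorSB]
    rw [Set.indicator_of_mem (show (0 : Fin (n + n) → FiniteAdeleRing (𝓞 F) F) ∈
      (piLevelIdeal F (Fin (n + n)) ⊤ : Set _) from (piLevelIdeal F (Fin (n + n)) ⊤).zero_mem)]
    exact one_ne_zero
  let S : Set (UnitaryGroup.arch F E c (n + n) (hermD F E e TV TW)) := {g | IsSiegelDelta F E c e TV TW (jA g)}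
  let κ : UnitaryGroup.arch F E c (n + n) (hermD F E e TV TW) → ℂ := fun g =>
    if h : IsSiegelDelta F E c e TV TW (jA g) then Classical.choose (horig g h) else 1
  let τ : UnitaryGroup.arch F E c (n + n) (hermD F E e TV TW) → ℂ := fun g =>
    (((chiDet F E c e TV TW χ (jA g) : ℂˣ) : ℂ) *
          (modDelta F E c e TV TW (jA g) : ℂ))
  have hcval : ∀ g ∈ S, ∀ Φ, opD F e TV TW (rDelta F e TV hVd TW hWd * adelicMpCont.twist F (Fin (n + n)) (gramDA F e TV TW) sa η g * (rDelta F e TV hVd TW hWd)⁻¹) Φ 0 =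
      κ g * (Φ : (Fin (n + n) → AdeleRing (𝓞 F) F) → ℂ) 0 := by
    intro g hg Φ
    have h : IsSiegelDelta F E c e TV TW (jA g) := hg
    simp only [κ, dif_pos h]
    exact (Classical.choose_spec (horig g h)).1 Φ
  have hcsq : ∀ g ∈ S, κ g ^ 2 = τ g ^ 2 := by
    intro g hg
    have h : IsSiegelDelta F E c e TV TW (jA g) := hg
    simp only [κ, τ, dif_pos h]
    exact (Classical.choose_spec (horig g h)).2
  have hSmul : ∀ p ∈ S, ∀ q ∈ S, p * q ∈ S := by
    intro p hp q hq
    show IsSiegelDelta F E c e TV TW (jA (p * q))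
    rw [map_mul]; exact isSiegelDelta_mul F E c e TV TW hp hq
  have hc : ∀ p ∈ S, ∀ q ∈ S, κ (p * q) = κ p * κ q := by
    intro p hp q hq
    have h1 := hcval (p * q) (hSmul p hp q hq) Φ₀
    rw [conj_twist_mul, opD_mul] at h1
    have h2 := hcval p hp (adelicMpCont.omega F (Fin (n + n)) (gramDA F e TV TW)
      (rDelta F e TV hVd TW hWd * adelicMpCont.twist F (Fin (n + n)) (gramDA F e TV TW) sa η q *
        (rDelta F e TV hVd TW hWd)⁻¹) Φ₀)
    have h3 := hcval q hq Φ₀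
    have h4 : κ (p * q) * (Φ₀ : (Fin (n + n) → AdeleRing (𝓞 F) F) → ℂ) 0 =
        κ p * (κ q * (Φ₀ : (Fin (n + n) → AdeleRing (𝓞 F) F) → ℂ) 0) := by
      rw [← h3, ← h1]
      exact h2
    rw [← mul_assoc] at h4
    exact mul_right_cancel₀ hΦ₀ h4
  have hτ : ∀ p ∈ S, ∀ q ∈ S, τ (p * q) = τ p * τ q :=
    fun p hp q hq => prescribed_mul F E c e TV TW jA χ hp hq
  have hτ0 : ∀ p ∈ S, τ p ≠ 0 := fun p _ => prescribed_ne_zero F E c e TV TW jA χ p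
  -- on squares `κ = τ` (`κ² = τ²`); on products of squares by induction; then on `(∏ qᵢ²) · q`, `q ∈ Q`
  have hsqr : ∀ q ∈ S, κ (q * q) = τ (q * q) := fun q hq => by
    rw [hc q hq q hq, hτ q hq q hq, ← sq, ← sq, hcsq q hq]
  have key : ∀ l : List (UnitaryGroup.arch F E c (n + n) (hermD F E e TV TW)), (∀ q ∈ l, q ∈ S) →
      (l.map fun q => q * q).prod ∈ S ∧ κ (l.map fun q => q * q).prod = τ (l.map fun q => q * q).prod := by
    intro l
    induction l with
    | nil =>
      intro _
      have hS1 : (1 : UnitaryGroup.arch F E c (n + n) (hermD F E e TV TW)) ∈ S := by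
        show IsSiegelDelta F E c e TV TW (jA 1)
        rw [map_one]; exact isSiegelDelta_one' F E c e TV TW
      refine ⟨by simpa using hS1, ?_⟩
      simp only [List.map_nil, List.prod_nil]
      -- `κ 1 = τ 1`: `κ 1 = κ 1 ²`-free argument via `κ(1·1) = κ 1 κ 1` and `τ` likewise, squares equal
      have hk := hc 1 hS1 1 hS1
      have ht := hτ 1 hS1 1 hS1
      rw [one_mul] at hk ht
      have hτ1 : τ 1 = 1 := (mul_right_eq_self₀.1 ht.symm).resolve_right (hτ0 1 hS1)
      rcases mul_right_eq_self₀.1 hk.symm with hk1 | hk0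
      · rw [hk1, hτ1]
      · have h2 := hcsq 1 hS1
        rw [hk0, hτ1] at h2
        norm_num at h2
    | cons q l ih =>
      intro hl
      have hq : q ∈ S := hl q (List.mem_cons_self)
      have hl' : ∀ q' ∈ l, q' ∈ S := fun q' hq' => hl q' (List.mem_cons_of_mem q hq')
      obtain ⟨hmem, hκτ⟩ := ih hl'
      have hqq : q * q ∈ S := hSmul q hq q hq
      refine ⟨?_, ?_⟩
      · rw [List.map_cons, List.prod_cons]; exact hSmul _ hqq _ hmem
      · rw [List.map_cons, List.prod_cons, hc _ hqq _ hmem, hτ _ hqq _ hmem, hsqr q hq, hκτ]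
  have hQval : ∀ q ∈ Q, κ q = τ q := by
    intro q hq
    have h1 := hcval q (hQ q hq) Φ₀
    rw [hval q hq Φ₀] at h1
    exact (mul_right_cancel₀ hΦ₀ h1).symm
  -- products of elements of `Q` (partial products stay in `S`)
  have keyQ : ∀ m : List (UnitaryGroup.arch F E c (n + n) (hermD F E e TV TW)), (∀ q ∈ m, q ∈ Q) →
      m.prod ∈ S ∧ κ m.prod = τ m.prod := by
    intro m
    induction m with
    | nil => intro _; simpa using (key [] (fun q hq => by simp at hq))
    | cons q m ih =>
      intro hm
      have hq : q ∈ Q := hm q (List.mem_cons_self)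
      have hm' : ∀ q' ∈ m, q' ∈ Q := fun q' hq' => hm q' (List.mem_cons_of_mem q hq')
      obtain ⟨hmem, hκτ⟩ := ih hm'
      refine ⟨?_, ?_⟩
      · rw [List.prod_cons]; exact hSmul _ (hQ q hq) _ hmem
      · rw [List.prod_cons, hc _ (hQ q hq) _ hmem, hτ _ (hQ q hq) _ hmem, hQval q hq, hκτ]
  have hcτ : ∀ p ∈ S, κ p = τ p := by
    intro p hp
    obtain ⟨l, m, hl, hmQ, rfl⟩ := hgen p hp
    obtain ⟨hmem, hκτ⟩ := key l hl
    obtain ⟨hmemQ, hκτQ⟩ := keyQ m hmQ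
    rw [hc _ hmem _ hmemQ, hτ _ hmem _ hmemQ, hκτ, hκτQ]
  -- (3) conclusion
  intro g hS _ Φ
  exact (hcval g hS Φ).trans (by rw [hcτ g hS])

include hsa hjA hdiagS in
/-- **THE ARCHIMEDEAN HALF FROM A FOLLAND-FRAMED SECTION, general `E/F`**: for a continuous character `η` of
`H(F ⊗ ℝ)` with `η(g)² · quot(sW g) · sgnA(g) = χ(det_Δ (g,1))²` on `P_Δ(F ⊗ ℝ)` and the prescription on a set `Q` of
representatives of `P_Δ(F ⊗ ℝ)` modulo squares, the twist `sa ⊗ η` of the archimedean lift `sa` of `(eW, sW)` is an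
archimedean half: `IsArchHalf χ (sa ⊗ η)`. [cite: GelbartRogawski1991, §3.1 Prop. 3.1.1 p. 455] -/
theorem isArchHalf_twist_archLift_of_reps (χ : HeckeCharacter E) (hcont : Continuous sa) (η : UnitaryGroup.arch F E c (n + n) (hermD F E e TV TW) →* ℂˣ)
    (hηc : Continuous fun g => ((η g : ℂˣ) : ℂ))
    (hηS : ∀ g : UnitaryGroup.arch F E c (n + n) (hermD F E e TV TW), IsSiegelDelta F E c e TV TW (jA g) →
      ((η g : ℂˣ) : ℂ) ^ 2 * MpS.quot (sW g) * (sgnA g : ℂ) = ((chiDet F E c e TV TW χ (jA g) : ℂˣ) : ℂ) ^ 2)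
    (Q : Set (UnitaryGroup.arch F E c (n + n) (hermD F E e TV TW)))
    (hQ : ∀ q ∈ Q, IsSiegelDelta F E c e TV TW (jA q))
    (hgen : ∀ p : UnitaryGroup.arch F E c (n + n) (hermD F E e TV TW), IsSiegelDelta F E c e TV TW (jA p) →
      ∃ (l m : List (UnitaryGroup.arch F E c (n + n) (hermD F E e TV TW))),
        (∀ q' ∈ l, IsSiegelDelta F E c e TV TW (jA q')) ∧ (∀ q ∈ m, q ∈ Q) ∧ p = (l.map fun q' => q' * q').prod * m.prod)
    (hval : ∀ q ∈ Q, ∀ Φ : piSchwartzBruhat F (Fin (n + n)),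
      opD F e TV TW (rDelta F e TV hVd TW hWd * adelicMpCont.twist F (Fin (n + n)) (gramDA F e TV TW) sa η q * (rDelta F e TV hVd TW hWd)⁻¹) Φ 0 =
        ((chiDet F E c e TV TW χ (jA q) : ℂˣ) : ℂ) * (modDelta F E c e TV TW (jA q) : ℂ) *
          (Φ : (Fin (n + n) → AdeleRing (𝓞 F) F) → ℂ) 0) :
    IsArchHalf F E c hcδ hδ hd e TV hV hVd TW hW hWd χ (adelicMpCont.twist F (Fin (n + n)) (gramDA F e TV TW) sa η) :=
  isArchHalf_twist F E c hcδ hδ hd e TV hV hVd TW hW hWd jA hjA eW sW hfin hdict sa hsa χ hcont η hηc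
    (parabolicPrescribed_twist_of_reps F E c hcδ hδ hd e TV hV hVd TW hW hWd jA eW sW hfin hdict sa hsa sgnA hdiagS χ η hηS Q hQ hgen hval)

end Parabolic

/-! ## §3 Bookkeeping for `hval`: the origin value of the twisted conjugate from that of `z · sW(q) · z⁻¹` -/

section Value

include hsa in
set_option maxHeartbeats 1600000 in
-- (instance unification on `𝓢`/`Mp(𝕎^𝔻)ᶜᵒⁿᵗ` operators is expensive)
/-- **the origin value of `r_δ (sa ⊗ η)(q) r_δ⁻¹` is `η(q) · c`** when the framed conjugate `z · sW(q) · z⁻¹` has origin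
value `c` (`(z sW(q) z⁻¹ f)(0) = c f(0)` on `𝓢(ℝ^σ)`), for ANY `z ∈ Mp^𝓢` over the archimedean phase map of `π(r_δ)`; so
the prescription `hval` at a representative `q` reads `η(q) · c_q = χ(det_Δ (q,1)) |det_Δ (q,1)|^{1/2}`.
[cite: Weil1964, Chap. III n° 38 pp. 189–190, n° 46 (42)] [cite: GelbartRogawski1991, §3.1 Prop. 3.1.1 p. 455] -/
theorem originValue_twist_eq (η : UnitaryGroup.arch F E c (n + n) (hermD F E e TV TW) →* ℂˣ)
    (z : MpS σ)
    (hz' : (⇑((MpS.proj z).1 : ((σ → ℝ) × (σ → ℝ)) ≃ₗ[ℝ] ((σ → ℝ) × (σ → ℝ))) : ((σ → ℝ) × (σ → ℝ)) → ((σ → ℝ) × (σ → ℝ))) =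
      archPhaseMap (gramDA F e TV TW) eW (isUnit_archMat_gramDA F e TV hVd TW hWd) (adelicMpCont.proj F (Fin (n + n)) (gramDA F e TV TW) (rDelta F e TV hVd TW hWd)))
    (q : UnitaryGroup.arch F E c (n + n) (hermD F E e TV TW)) {cq : ℂ}
    (hcq : ∀ f : SchwartzMap (σ → ℝ) ℂ, (z * sW q * z⁻¹).1.2 f 0 = cq * f 0) (Φ : piSchwartzBruhat F (Fin (n + n))) :
    opD F e TV TW (rDelta F e TV hVd TW hWd * adelicMpCont.twist F (Fin (n + n)) (gramDA F e TV TW) sa η q * (rDelta F e TV hVd TW hWd)⁻¹) Φ 0 =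
      ((η q : ℂˣ) : ℂ) * cq * (Φ : (Fin (n + n) → AdeleRing (𝓞 F) F) → ℂ) 0 := by
  obtain ⟨A, P, hr⟩ := exists_omega_tmul (gramDA F e TV TW)
    (mulVec_surjective_of_isUnit_det F (gramDA F e TV TW) (isUnit_det_gramDA F e TV hVd TW hWd)) (rDelta F e TV hVd TW hWd)
  subst hsa
  have h0 := omega_conj_archLift_apply_zero (gramDA F e TV TW) eW (isUnit_archMat_gramDA F e TV hVd TW hWd)
    ((toSpD F E c hcδ hδ hd e TV hV TW hW).comp jA) sW hfin hdict (rDelta F e TV hVd TW hWd) A P hr z hz' q hcq Φ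
  rw [conj_twist_eq, opD_mul]
  simp only [opD, adelicMpCont.omega_ofScalar, Submodule.coe_smul, Pi.smul_apply, smul_eq_mul]
  rw [h0]
  ring

include hsa in
/-- hence: if the framed conjugate `z · sW(q) · z⁻¹` has origin value `1` (e.g. `sW(q)` a conjugated orthogonal Levi element,
`Weil1964.MpS.conj_leviGL_apply_zero_of_orthogonal`) and `η(q) = χ(det_Δ (q,1)) |det_Δ (q,1)|^{1/2}`, the prescription
`hval` holds at `q`. [cite: GelbartRogawski1991, §3.1 Prop. 3.1.1 p. 455] -/
theorem hval_of_originValue_one (χ : HeckeCharacter E) (η : UnitaryGroup.arch F E c (n + n) (hermD F E e TV TW) →* ℂˣ)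
    (z : MpS σ)
    (hz' : (⇑((MpS.proj z).1 : ((σ → ℝ) × (σ → ℝ)) ≃ₗ[ℝ] ((σ → ℝ) × (σ → ℝ))) : ((σ → ℝ) × (σ → ℝ)) → ((σ → ℝ) × (σ → ℝ))) =
      archPhaseMap (gramDA F e TV TW) eW (isUnit_archMat_gramDA F e TV hVd TW hWd) (adelicMpCont.proj F (Fin (n + n)) (gramDA F e TV TW) (rDelta F e TV hVd TW hWd)))
    (q : UnitaryGroup.arch F E c (n + n) (hermD F E e TV TW))
    (hone : ∀ f : SchwartzMap (σ → ℝ) ℂ, (z * sW q * z⁻¹).1.2 f 0 = 1 * f 0)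
    (hηq : ((η q : ℂˣ) : ℂ) = ((chiDet F E c e TV TW χ (jA q) : ℂˣ) : ℂ) * (modDelta F E c e TV TW (jA q) : ℂ))
    (Φ : piSchwartzBruhat F (Fin (n + n))) :
    opD F e TV TW (rDelta F e TV hVd TW hWd * adelicMpCont.twist F (Fin (n + n)) (gramDA F e TV TW) sa η q * (rDelta F e TV hVd TW hWd)⁻¹) Φ 0 =
      ((chiDet F E c e TV TW χ (jA q) : ℂˣ) : ℂ) * (modDelta F E c e TV TW (jA q) : ℂ) *
        (Φ : (Fin (n + n) → AdeleRing (𝓞 F) F) → ℂ) 0 := by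
  rw [originValue_twist_eq F E c hcδ hδ hd e TV hV hVd TW hW hWd jA eW sW hfin hdict sa hsa η z hz' q hone Φ, mul_one, hηq]

end Value

end Literature.NumberTheory.GelbartRogawski1991.GRConstructionGen

end
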